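import Literature.Analysis.FluidPDE.NovackBallAvgBalance
import HarnessLib

/-!
# Novack's longitudinal balance at scale `ℓ` (Novack 2024, Thm. 1, line `• = L`) and the assembly

Topic: Analysis/FluidPDE, the decomposition of the `4/5`-law half of the named fact
`Torus.novack2024_fourThirds_fourFifths` (`Literature.Analysis.FluidPDE.NovackScalingLaws`;
M. Novack, *Scaling laws and exact results in turbulence*, Nonlinearity 37 (2024) 095002, Thm. 1)
along the printed proof (op. cit. §2, Step 2), and the **proved assembly**
`Torus.novack2024_fourThirds_fourFifths_of_balances` of the whole fact from the four scale-`ℓ`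
facts (two here, two in `Literature.Analysis.FluidPDE.NovackBallAvgBalance`).

## The printed proof of the line `• = L` (§2, Step 2) and its transcription

With the tensors `T_L(y) = ŷ ⊗ ŷ`, `T_T(y) = 1 − ŷ ⊗ ŷ` (`ŷ = y/|y|`, (tensors)) Novack runs the
computation of Step 1 for the matrix kernels `T_•(y) η(y)` (the pressure terms become gradients
of potentials `ζ̃`, `∂ₖζ̃ = ∂ᵢ(T^{ik}_• η)`, first display of Step 2), obtaining the balances (last:one:L) whose
right-hand sides are, for `• = L`, `−½ ∫ φ [∇η·δu |T_L δu|² + (2y/|y|²) η·δu |δu T_T|²] dy` and, for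
`• = T`, `−½ ∫ φ (∇η − (2y/|y|²)η)·δu |δu T_T|² dy` ((mess:one), (mess:two)). To kill the transverse
remainder he takes `• = L` with the ball kernel `|B_ℓ|⁻¹ 1_{B_ℓ}` (`γ = 0`) and **subtracts**
`• = T` with the kernel `ζ_ℓ(y) = |B_ℓ|⁻¹ (|y|²/ℓ² − 1) 1_{B_ℓ}(y)`, for which
`∇ζ_ℓ − (2y/|y|²)ζ_ℓ = (2y/(|B_ℓ| |y|²)) 1_{B_ℓ}` (the display after (ODE)); all terms being linear in the matrix
kernel, the result is the balance (last:one:L:L) for the **combined kernel** ((you:ell:ell))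
`M_ℓ(y) = |B_ℓ|⁻¹ 1_{B_ℓ}(y) T_L(y) − ζ_ℓ(y) T_T(y) = |B_ℓ|⁻¹ 1_{B_ℓ}(y) [(1 − |y|²/ℓ²) 1 + ℓ⁻² y ⊗ y]`,
with right-hand side `(d/(2ℓ)) ∫∫ ⨍_{S^{d−1}} φ y·δu |T_L(y) δu|²(ℓy) dy`, `y·δu |T_L δu|² = (y·δu)³`.
The objects of (last:one:L:L), in the notation (increments a–c) of the source and as defined here
(`u₊ = u(x+y)`, averages `⨍_{B_ℓ}` = `|B_ℓ|⁻¹ ∫_{B_ℓ}`):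
* `u_{L,ℓ}(x) = ∫ M_ℓ(y) u(x+y) dy = ⨍_{B_ℓ} [(1 − |y|²/ℓ²) u₊ + ℓ⁻² (y·u₊) y] dy` — `Torus.longAvg`;
* `(|u_L|²)_ℓ(x) = ∫ ⟪u₊, M_ℓ(y) u₊⟫ dy = ⨍_{B_ℓ} [(1 − |y|²/ℓ²)|u₊|² + ℓ⁻² (y·u₊)²] dy` —
  `Torus.longAvgSq`; `(uʲ|u_L|²)_ℓ(x) = ∫ uʲ₊ ⟪u₊, M_ℓ(y) u₊⟫ dy` — `Torus.longAvgCube`;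
* `p_{L,ℓ} = ∫ ζ̃_ℓ(y) p(x+y) dy` ("defined analogously", i.e. through the potential of
  `∂ᵢ M^{ik}_ℓ = ∂ₖ ζ̃_ℓ`): for the combined kernel the compactly supported potential is
  `ζ̃_ℓ(y) = |B_ℓ|⁻¹ [1 − ((d−1)/2)(1 − |y|²/ℓ²)] 1_{B_ℓ}(y)` (from
  `div(a 1 + b ŷ⊗ŷ) = (a' + b' + (d−1)b/r) ŷ` with `a = |B_ℓ|⁻¹(1 − r²/ℓ²)`, `b = |B_ℓ|⁻¹ r²/ℓ²`,
  the jump of `b` at `r = ℓ` included) — `Torus.longAvgPressure`. Its mass is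
  `∫ ζ̃_ℓ = 3/(d+2) = tr ∫ M_ℓ / d`, the constant of the source's (claim)
  `g_{L,ℓ} → (3d/(d(d+2))) g` and of "computing similarly for `p_{L,ℓ}`".
Tested with `ψ` supported in `(0,T) × T^d`, with `ν = 0`, `f = 0`, and multiplied by `2`,
(last:one:L:L) is `Torus.novack2024_longAvg_balance`:
`𝒩^L_ℓ(ψ) = −(d/ℓ) ∫₀ᵀ∫ ⨍ (δu·ω)³(ℓω) dω ψ` with
`𝒩^L_ℓ(ψ) = 2∫∫⟪u,u_{L,ℓ}⟫∂ₜψ + 2∫∫⟪u,u_{L,ℓ}⟫⟪u,∇ψ⟫ + ∫∫⟪(u|u_L|²)_ℓ,∇ψ⟫ − ∫∫(|u_L|²)_ℓ⟪u,∇ψ⟫ + 2∫∫p⟪u_{L,ℓ},∇ψ⟫ + 2∫∫p_{L,ℓ}⟪u,∇ψ⟫`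
(`Torus.novackLongPairing`); the limit `ℓ → 0` ("passing to the limit `ℓ → 0` in
(last:one:L:L), we obtain that the left-hand side converges to `3d/(d(d+2))` multiplied by the
left-hand side of (eq:main:balance)", via the (claim) `‖g_{L,ℓ} − (3/(d+2)) g‖_p → 0`) is
`Torus.novack2024_longAvg_balance_tendsto`. From them the local 4/5 law is **proved**
(`Torus.hasFourFifthsLaw_of_longAvg_balance`:
`ℓ⁻¹∫∫⨍(δ_L u)³ψ = −d⁻¹ 𝒩^L_ℓ(ψ) → −d⁻¹ (3/(d+2)) 4 D ψ = −(12/(d(d+2))) D ψ`).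

## Design notes and disclosures

* Conventions as in `NovackBallAvgBalance` (ball averages over `B_ℓ ⊂ ℝ^d` through the covering
  map, `0 < ℓ < 1/2`, the full hypothesis block of Thm. 1).
* **What is transcribed versus printed.** The source prints (last:one:L:L) with the symbols
  `u_{L,ℓ}` ((you:ell:ell), explicit), `(uʲ|u_L|²)_ℓ`, `(|u_L|²)_ℓ` ((increments b–c) with the combined
  kernel) and `p_{L,ℓ}` ("defined analogously"); the closed forms above expand
  `T_L + (1 − |y|²/ℓ²) T_T = (1 − |y|²/ℓ²) 1 + (|y|²/ℓ²) ŷ⊗ŷ` and compute the pressure potential,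
  which the source leaves implicit. The whole scale-`ℓ` identity was re-derived for smooth
  solutions and isotropic matrix kernels `M = a(|y|) 1 + b(|y|) ŷ⊗ŷ` —
  `∂ₜ⟪u,u_M⟫ + div(u⟪u,u_M⟫ + ½(V_M − u S_M)) + div(p u_M + p_{ζ̃} u) = −½ ∫ ∂ₖM^{ij} δuⁱδuʲδuᵏ dy`,
  cubic integrand `(a' + b')(δ_L u)³ + (a' + 2b/r) δ_L u |δ_T u|²` — confirming that for `M_ℓ` the
  transverse coefficient `a' + 2b/r` vanishes identically and `a' + b' = −|B_ℓ|⁻¹ δ(r − ℓ)`, whence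
  the right-hand side `−(d/(2ℓ)) ⨍ (δ_L u)³`; the potential `ζ̃_ℓ` passes the moment checks
  `∫ζ̃_ℓ = d⁻¹ tr∫M_ℓ`, `(d+2)∫|y|²ζ̃_ℓ = ∫(|y|² tr M_ℓ + 2 yᵀM_ℓy)`; and the identity
  `𝒩^L_ℓ(ψ) = −(d/ℓ)∫∫⨍(δu·ω)³ψ` was checked numerically (to `10⁻¹⁴` relative, all six terms
  of `𝒩^L_ℓ` being of order one) on the exact time-dependent Euler solution
  `u = U(x − ct) + c`, `p = P(x − ct)` on `T²` (`U` the Taylor–Green field), scales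
  `ℓ = 0.18, 0.31`, before being stated.
* **Sign disclosure** as in `NovackBallAvgBalance`: both pressure terms enter with the same sign.

## References

* M. Novack, *Scaling laws and exact results in turbulence*, Nonlinearity 37 (2024) 095002,
  arXiv:2310.01375: §1 (tensors), §2 (increments a–c) (mollifications), Step 2 (potentials `ζ̃`,
  (withkappa), (last:one:L), (mess:one), (mess:two), (ODE), (last:one:L:L), (you:ell:ell),
  (claim) and the closing paragraph); equation labels are the `\label`s of the arXiv source (the
  held text does not carry the printed numbers). [Novack2024]
* G. L. Eyink, Nonlinearity 16 (2003) 137–145, Thm. 1 (the integrands of `D_L^ε`, `D_T^ε`). [Eyink2003]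
-/

noncomputable section

open MeasureTheory TopologicalSpace Set Function Filter Metric
open _root_.Topology
open scoped InnerProductSpace RealInnerProductSpace ENNReal NNReal

namespace Literature.Analysis.FluidPDE.Torus

variable {d : Type*} [Fintype d]

/-! ## Novack's combined longitudinal kernel: the four averages -/

section LongAvg

/-- **Novack's longitudinal average** `u_{L,ℓ}` ((you:ell:ell)):
`u_{L,ℓ}(x) = ∫ (|B_ℓ|⁻¹ 1_{B_ℓ} T_L − ζ_ℓ T_T)(y) u(x+y) dy = ⨍_{B_ℓ} [(1 − |y|²/ℓ²) u(x+y) + ℓ⁻² ⟪y, u(x+y)⟫ y] dy`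
(`T_L = ŷ⊗ŷ`, `T_T = 1 − ŷ⊗ŷ`, `ζ_ℓ = |B_ℓ|⁻¹(|y|²/ℓ² − 1) 1_{B_ℓ}`), the separation acting
through the covering map. [cite: Novack2024, Sect. 2 Step 2 (you:ell:ell)] -/
def longAvg (u : UnitAddTorus d → EuclideanSpace ℝ d) (ℓ : ℝ) (x : UnitAddTorus d) :
    EuclideanSpace ℝ d :=
  ⨍ y in ball (0 : EuclideanSpace ℝ d) ℓ,
    ((1 - ‖y‖ ^ 2 / ℓ ^ 2) • u (x + FunctionSpaces.Torus.proj y) +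
      (ℓ ^ 2)⁻¹ • ⟪y, u (x + FunctionSpaces.Torus.proj y)⟫ • y)

/-- **The combined-kernel quadratic average** `(|u_L|²)_ℓ` ((increments c) with `f = 1` and the kernel
of (you:ell:ell)): `⨍_{B_ℓ} [(1 − |y|²/ℓ²) |u(x+y)|² + ℓ⁻² ⟪y, u(x+y)⟫²] dy = ∫ ⟪u(x+y), M_ℓ(y) u(x+y)⟫ dy`. [cite: Novack2024, Sect. 2 (increments) and Step 2 (you:ell:ell)] -/
def longAvgSq (u : UnitAddTorus d → EuclideanSpace ℝ d) (ℓ : ℝ) (x : UnitAddTorus d) : ℝ :=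
  ⨍ y in ball (0 : EuclideanSpace ℝ d) ℓ,
    ((1 - ‖y‖ ^ 2 / ℓ ^ 2) * ‖u (x + FunctionSpaces.Torus.proj y)‖ ^ 2 +
      (ℓ ^ 2)⁻¹ * ⟪y, u (x + FunctionSpaces.Torus.proj y)⟫ ^ 2)

/-- **The combined-kernel cubic average** `(u |u_L|²)_ℓ` ((increments c) with `f = uʲ` and the kernel of
(you:ell:ell)): `⨍_{B_ℓ} [(1 − |y|²/ℓ²) |u(x+y)|² + ℓ⁻² ⟪y, u(x+y)⟫²] u(x+y) dy`. [cite: Novack2024, Sect. 2 (increments) and Step 2 (you:ell:ell)] -/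
def longAvgCube (u : UnitAddTorus d → EuclideanSpace ℝ d) (ℓ : ℝ) (x : UnitAddTorus d) :
    EuclideanSpace ℝ d :=
  ⨍ y in ball (0 : EuclideanSpace ℝ d) ℓ,
    ((1 - ‖y‖ ^ 2 / ℓ ^ 2) * ‖u (x + FunctionSpaces.Torus.proj y)‖ ^ 2 +
      (ℓ ^ 2)⁻¹ * ⟪y, u (x + FunctionSpaces.Torus.proj y)⟫ ^ 2) • u (x + FunctionSpaces.Torus.proj y)

variable (d) in
/-- **Novack's longitudinal pressure average** `p_{L,ℓ}` ("defined analogously" after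
(you:ell:ell): convolution with the potential `ζ̃_ℓ` of the combined kernel,
`∂ᵢ M_ℓ^{ik} = ∂ₖ ζ̃_ℓ`, first display of Step 2): `p_{L,ℓ}(x) = ⨍_{B_ℓ} [1 − ((d−1)/2)(1 − |y|²/ℓ²)] p(x+y) dy`
(the compactly supported potential, of mass `3/(d+2)`; transcription, see the module docstring). [cite: Novack2024, Sect. 2 Step 2, potentials ζ̃ and (you:ell:ell)] -/
def longAvgPressure (p : UnitAddTorus d → ℝ) (ℓ : ℝ) (x : UnitAddTorus d) : ℝ :=
  ⨍ y in ball (0 : EuclideanSpace ℝ d) ℓ,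
    (1 - ((Fintype.card d : ℝ) - 1) / 2 * (1 - ‖y‖ ^ 2 / ℓ ^ 2)) * p (x + FunctionSpaces.Torus.proj y)

/-- The longitudinal average of the zero field vanishes. [folklore] -/
@[simp]
theorem longAvg_zero (ℓ : ℝ) : longAvg (0 : UnitAddTorus d → EuclideanSpace ℝ d) ℓ = 0 := by
  funext x
  simp [longAvg]

/-- The quadratic average of the zero field vanishes. [folklore] -/
@[simp]
theorem longAvgSq_zero (ℓ : ℝ) : longAvgSq (0 : UnitAddTorus d → EuclideanSpace ℝ d) ℓ = 0 := by
  funext x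
  simp [longAvgSq]

/-- The cubic average of the zero field vanishes. [folklore] -/
@[simp]
theorem longAvgCube_zero (ℓ : ℝ) : longAvgCube (0 : UnitAddTorus d → EuclideanSpace ℝ d) ℓ = 0 := by
  funext x
  simp [longAvgCube]

/-- The longitudinal pressure average of the zero pressure vanishes. [folklore] -/
@[simp]
theorem longAvgPressure_zero (ℓ : ℝ) : longAvgPressure d (0 : UnitAddTorus d → ℝ) ℓ = 0 := by
  funext x
  simp [longAvgPressure]

end LongAvg

/-! ## Novack's scale-`ℓ` longitudinal pairing and the two named facts -/

section Facts

/-- **Novack's scale-`ℓ` longitudinal pairing** `𝒩^L_ℓ(ψ)`: twice the left-hand side of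
(last:one:L:L) (`ν = 0`, `f = 0`) tested against a scalar `ψ` supported in `(0,T) × T^d`,
`𝒩^L_ℓ(ψ) = 2∫₀ᵀ∫ ⟪u, u_{L,ℓ}⟫ ∂ₜψ + 2∫₀ᵀ∫ ⟪u, u_{L,ℓ}⟫ ⟪u, ∇ψ⟫ + ∫₀ᵀ∫ ⟪(u|u_L|²)_ℓ, ∇ψ⟫
  − ∫₀ᵀ∫ (|u_L|²)_ℓ ⟪u, ∇ψ⟫ + 2∫₀ᵀ∫ p ⟪u_{L,ℓ}, ∇ψ⟫ + 2∫₀ᵀ∫ p_{L,ℓ} ⟪u, ∇ψ⟫`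
(`longAvg`, `longAvgCube`, `longAvgSq`, `longAvgPressure`). [cite: Novack2024, Sect. 2 Step 2 (last:one:L:L)] -/
def novackLongPairing (T : ℝ) (u : ℝ → UnitAddTorus d → EuclideanSpace ℝ d)
    (p : ℝ → UnitAddTorus d → ℝ) (ψ : ℝ → UnitAddTorus d → ℝ) (ℓ : ℝ) : ℝ :=
  2 * (∫ t in Ioo 0 T, ∫ x, ⟪u t x, longAvg (u t) ℓ x⟫ * FunctionSpaces.Torus.timeDeriv ψ t x) +
    2 * (∫ t in Ioo 0 T, ∫ x,
      ⟪u t x, longAvg (u t) ℓ x⟫ * ⟪u t x, FunctionSpaces.Torus.gradient (ψ t) x⟫) +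
    (∫ t in Ioo 0 T, ∫ x, ⟪longAvgCube (u t) ℓ x, FunctionSpaces.Torus.gradient (ψ t) x⟫) -
    (∫ t in Ioo 0 T, ∫ x, longAvgSq (u t) ℓ x * ⟪u t x, FunctionSpaces.Torus.gradient (ψ t) x⟫) +
    2 * (∫ t in Ioo 0 T, ∫ x, p t x * ⟪longAvg (u t) ℓ x, FunctionSpaces.Torus.gradient (ψ t) x⟫) +
    2 * (∫ t in Ioo 0 T, ∫ x,
      longAvgPressure d (p t) ℓ x * ⟪u t x, FunctionSpaces.Torus.gradient (ψ t) x⟫)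

/-- **Novack 2024, §2 Step 2: the scale-`ℓ` longitudinal balance** ((last:one:L:L), Euler case
`ν = 0`, unforced, whose right-hand side is
`(d/(2ℓ)) ∫∫ ⨍_{S^{d−1}} φ y·δu |T_L(y) δu|²(ℓy) dy`, `y·δu |T_L δu|² = (y·δu)³`). Under the
hypotheses of Thm. 1 — `d ≥ 2`, `(u, p)` a weak solution in Novack's sense on `[0,T] × T^d` with
`u ∈ L³ ∩ C⁰([0,T]; L²)`, `p ∈ L^{3/2}`, `u₀ ∈ L²` — for every scale `0 < ℓ < 1/2` and every test
function `ψ` supported in `(0,T) × T^d`: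
`𝒩^L_ℓ(ψ) = −(d/ℓ) ∫₀ᵀ∫ ⨍_{S^{d−1}} (δu(t,x;ℓω)·ω)³ dω ψ(t,x) dx dt`
(`Torus.novackLongPairing`, `Torus.longitudinalFluxSphereAvg`; transcription of the symbols as
recorded in the module docstring). [cite: Novack2024, Sect. 2 Step 2 (last:one:L:L)] -/
def novack2024_longAvg_balance : Prop :=
  ∀ [DecidableEq d] {T : ℝ} {u₀ : UnitAddTorus d → EuclideanSpace ℝ d}
    {u : ℝ → UnitAddTorus d → EuclideanSpace ℝ d} {p : ℝ → UnitAddTorus d → ℝ},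
    2 ≤ Fintype.card d → 0 < T → IsWeakEulerSolutionWithPressureOn T 0 u₀ u p →
    ContinuousInLpOn (Icc 0 T) 2 u → (∫⁻ t in Ioo 0 T, ∫⁻ x, ‖u t x‖ₑ ^ (3 : ℕ) < ∞) →
    (∫⁻ t in Ioo 0 T, ∫⁻ x, ‖p t x‖ₑ ^ (3 / 2 : ℝ) < ∞) → MemLp u₀ 2 volume →
    ∀ {ℓ : ℝ}, 0 < ℓ → ℓ < 1 / 2 →
    ∀ {ψ : ℝ → UnitAddTorus d → ℝ}, FunctionSpaces.Torus.IsSpaceTimeTestIoo T ψ →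
      novackLongPairing T u p ψ ℓ =
        -((Fintype.card d : ℝ) / ℓ) *
          ∫ t in Ioo 0 T, ∫ x, longitudinalFluxSphereAvg (u t) ℓ x * ψ t x

/-- **Novack 2024, §2 Step 2: the limit `ℓ → 0` of the longitudinal balance** ("combining these
results, and passing to the limit `ℓ → 0` in (last:one:L:L), we obtain that the left-hand side
converges to `3d/(d(d+2))` multiplied by the left-hand side of (eq:main:balance)", resting on the
(claim) `lim_{ℓ→0} ∫ |g_{L,ℓ} − (3d/(d(d+2))) g|ᵖ = 0` for `Lᵖ` fields and the masses
`∫ |B_ℓ|⁻¹1_{B_ℓ} T_L = d⁻¹ 1`, `∫ ζ_ℓ T_T = −(2(d−1)/(d(d+2))) 1`). Under the hypotheses of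
Thm. 1, for every test function `ψ` supported in `(0,T) × T^d`, as `ℓ → 0⁺`,
`𝒩^L_ℓ(ψ) → (3/(d+2)) ∫₀ᵀ∫ (2|u|² ∂ₜψ + 2|u|² ⟪u, ∇ψ⟫ + 4 p ⟪u, ∇ψ⟫)`. [cite: Novack2024, Sect. 2 Step 2 (claim) and limit ℓ → 0] -/
def novack2024_longAvg_balance_tendsto : Prop :=
  ∀ [DecidableEq d] {T : ℝ} {u₀ : UnitAddTorus d → EuclideanSpace ℝ d}
    {u : ℝ → UnitAddTorus d → EuclideanSpace ℝ d} {p : ℝ → UnitAddTorus d → ℝ},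
    2 ≤ Fintype.card d → 0 < T → IsWeakEulerSolutionWithPressureOn T 0 u₀ u p →
    ContinuousInLpOn (Icc 0 T) 2 u → (∫⁻ t in Ioo 0 T, ∫⁻ x, ‖u t x‖ₑ ^ (3 : ℕ) < ∞) →
    (∫⁻ t in Ioo 0 T, ∫⁻ x, ‖p t x‖ₑ ^ (3 / 2 : ℝ) < ∞) → MemLp u₀ 2 volume →
    ∀ {ψ : ℝ → UnitAddTorus d → ℝ}, FunctionSpaces.Torus.IsSpaceTimeTestIoo T ψ →
      Tendsto (fun ℓ => novackLongPairing T u p ψ ℓ) (𝓝[>] 0)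
        (𝓝 (3 / ((Fintype.card d : ℝ) + 2) * ∫ t in Ioo 0 T, ∫ x,
          (2 * (‖u t x‖ ^ 2 * FunctionSpaces.Torus.timeDeriv ψ t x) +
            2 * (‖u t x‖ ^ 2 * ⟪u t x, FunctionSpaces.Torus.gradient (ψ t) x⟫) +
            4 * (p t x * ⟪u t x, FunctionSpaces.Torus.gradient (ψ t) x⟫))))

end Facts

/-! ## The local 4/5 law from the two facts, and the assembly of Theorem 1 (`• = I, L`) -/

/-- The constant bookkeeping of the closing paragraph of §2 Step 2 ("dividing the factor of `d/2`
… by twice `3d/(d(d+2))`"): `−d⁻¹ · (3/(d+2)) · 4 = −12/(d(d+2))`. [cite: Novack2024, Sect. 2 Step 2] -/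
theorem neg_inv_card_mul_three_div (hd : Fintype.card d ≠ 0) (c : ℝ) :
    -(Fintype.card d : ℝ)⁻¹ * (3 / ((Fintype.card d : ℝ) + 2) * (4 * c)) = -fourFifthsConst d * c := by
  have hd0 : (Fintype.card d : ℝ) ≠ 0 := by exact_mod_cast hd
  have hd2 : (Fintype.card d : ℝ) + 2 ≠ 0 := by positivity
  rw [fourFifthsConst]
  field_simp
  ring

section Assembly

variable [DecidableEq d] {T : ℝ} {u : ℝ → UnitAddTorus d → EuclideanSpace ℝ d}
  {u₀ : UnitAddTorus d → EuclideanSpace ℝ d} {p : ℝ → UnitAddTorus d → ℝ}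

/-- **The local 4/5 law from Novack's scale-`ℓ` longitudinal balance** (Novack 2024, Thm. 1,
line `• = L`, assembled as in §2 Step 2): granted `novack2024_longAvg_balance` and
`novack2024_longAvg_balance_tendsto`, under the hypotheses of Thm. 1 every `D` with the local
energy balance satisfies `HasFourFifthsLaw T u D`:
`∫∫ ℓ⁻¹ ⨍ (δ_L u)³ ψ = −d⁻¹ 𝒩^L_ℓ(ψ) → −d⁻¹ (3/(d+2)) 4 D ψ = −(12/(d(d+2))) D ψ`. [cite: Novack2024, Thm. 1] -/
theorem hasFourFifthsLaw_of_longAvg_balance (hB : novack2024_longAvg_balance (d := d))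
    (hL : novack2024_longAvg_balance_tendsto (d := d)) (hd : 2 ≤ Fintype.card d) (hT : 0 < T)
    (hsol : IsWeakEulerSolutionWithPressureOn T 0 u₀ u p) (hC : ContinuousInLpOn (Icc 0 T) 2 u)
    (hu3 : ∫⁻ t in Ioo 0 T, ∫⁻ x, ‖u t x‖ₑ ^ (3 : ℕ) < ∞)
    (hp : ∫⁻ t in Ioo 0 T, ∫⁻ x, ‖p t x‖ₑ ^ (3 / 2 : ℝ) < ∞) (hu₀ : MemLp u₀ 2 volume)
    {G : ℝ → UnitAddTorus d → EuclideanSpace ℝ d →L[ℝ] EuclideanSpace ℝ d} {D : STFunctional d}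
    (hbal : HasLocalEnergyBalance T 0 u p G D) : HasFourFifthsLaw T u D := by
  intro ψ hψ
  have hd0 : (Fintype.card d : ℝ) ≠ 0 := by exact_mod_cast (show Fintype.card d ≠ 0 by omega)
  have hev : ∀ᶠ ℓ in 𝓝[>] (0 : ℝ), -(Fintype.card d : ℝ)⁻¹ * novackLongPairing T u p ψ ℓ =
      ∫ t in Ioo 0 T, ∫ x, ℓ⁻¹ * longitudinalFluxSphereAvg (u t) ℓ x * ψ t x := by
    filter_upwards [Ioo_mem_nhdsGT (show (0 : ℝ) < 1 / 2 by norm_num)] with ℓ hℓ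
    have hℓ0 : ℓ ≠ 0 := hℓ.1.ne'
    rw [hB hd hT hsol hC hu3 hp hu₀ hℓ.1 hℓ.2 hψ]
    have hpull : ∫ t in Ioo 0 T, ∫ x, ℓ⁻¹ * longitudinalFluxSphereAvg (u t) ℓ x * ψ t x =
        ℓ⁻¹ * ∫ t in Ioo 0 T, ∫ x, longitudinalFluxSphereAvg (u t) ℓ x * ψ t x := by
      rw [← integral_const_mul]
      refine integral_congr_ae (ae_of_all _ fun t => ?_)
      simp only
      rw [← integral_const_mul]
      refine integral_congr_ae (ae_of_all _ fun x => ?_)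
      simp only
      ring
    rw [hpull]
    field_simp
  have hlim := (hL hd hT hsol hC hu3 hp hu₀ hψ).const_mul (-(Fintype.card d : ℝ)⁻¹)
  rw [hbal.integral_two_mul_eq hψ, neg_inv_card_mul_three_div (by omega) (D ψ)] at hlim
  exact hlim.congr' hev

end Assembly

/-- **Novack 2024, Thm. 1, lines `• = I, L`, assembled from the four scale-`ℓ` facts**: granted
the ball-kernel balance and its limit (`novack2024_ballAvg_balance`,
`novack2024_ballAvg_balance_tendsto`, §2 Step 1) and the longitudinal balance and its limit
(`novack2024_longAvg_balance`, `novack2024_longAvg_balance_tendsto`, §2 Step 2), the named fact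
`novack2024_fourThirds_fourFifths` holds: for Novack weak Euler solutions with
`u ∈ L³ ∩ C⁰_t L²_x`, `p ∈ L^{3/2}`, `u₀ ∈ L²`, `d ≥ 2`, every `D` with the local energy
balance satisfies the local 4/3 and 4/5 laws. [cite: Novack2024, Thm. 1] -/
theorem novack2024_fourThirds_fourFifths_of_balances (hI : novack2024_ballAvg_balance (d := d))
    (hIlim : novack2024_ballAvg_balance_tendsto (d := d))
    (hL : novack2024_longAvg_balance (d := d)) (hLlim : novack2024_longAvg_balance_tendsto (d := d)) :
    novack2024_fourThirds_fourFifths (d := d) :=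
  fun hd hT hsol hC hu3 hp hu₀ _ _ hbal =>
    ⟨hasFourThirdsLaw_of_ballAvg_balance hI hIlim hd hT hsol hC hu3 hp hu₀ hbal,
      hasFourFifthsLaw_of_longAvg_balance hL hLlim hd hT hsol hC hu3 hp hu₀ hbal⟩


end Literature.Analysis.FluidPDE.Torus
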